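import Summits.HodgeConjecture.CorCM.Census.CyclicCharacterArcReduction
import Summits.HodgeConjecture.CorCM.Census.OddIndexGeneration

/-!
# Cyclic characters, XI: THE FIBRE OBSTRUCTION — no complete reduction onto the arc block when `ker w ≠ 1`

COR-CM (cell `pub-hodgecm2`), count-neutral kernel combinatorics by the binder seat b09 (gen 42; lane CYCLIC-CHARACTER FIBRE LAW, part XI —
an AUDIT of the arc-type road map of gen 41, parts IX §4 and X).  Theorems only (no definition, no `decide`, no certificate, no named fact, no
`sorry`).
HONEST FRAMING: `HC_CM` is NOT proved, here or anywhere in the tree; nothing here is a period or a headline.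

THE SETTING of parts I–X: `G` finite, `c` a central involution, `w : G → ℤ/2ᵏ` additive with `w c ≠ 0`, the arc type `T_0 = w⁻¹(arc)`
(`Census/CyclicCharacterArcType.lean`), its single flips `T_0^{(s)}` (`s ∈ T_0`), the Hodge lattice `hodgeSpan = ℤ⟨faces⟩ + ℤ⟨pairs⟩`.

THE POINT.  Gen 41ʼs arc reduction theorem (`CyclicCharacter.two_pow_smul_mem_of_arc_reduction`, part IX §4) and the three ARC-TYPE META THEOREMS
(`CyclicCharacter.isLeast_card_gfaces_generate_of_arcCert_isPGroup/_rel/_supported`, part X) carry the hypothesis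

  `hflip : ∀ s ∈ T_0, 2ʲ·[T_0^{(s)}] ∈ (ℤ⟨pairs⟩ + ℤ[G]·S₀) + ℤ⟨arc block⟩`   (resp. `hred : ∀ Φ, 2ʲ·[Φ] ∈ L + ℤ⟨arc block⟩`, `L ≤ hodgeSpan`),

the «closing faces» step (flip) of the road map `HOME/pub-hodgecm2-b09/lean-g41/METACYCLIC-ROADMAP.md`.  THIS FILE PROVES THAT `hflip` / `hred` IS
UNSATISFIABLE AS SOON AS `ker w` HAS A NON-TRIVIAL ELEMENT (`not_two_pow_smul_single_oflipCM_mem`, `apply_eq_zero_imp_eq_one_of_hflip`): those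
theorems are true but VACUOUS for every member of the class with `|ker w| ≥ 2` — in particular for the whole odd-kernel column (`ℤ/m ⋊ ℤ/2ᵏ`,
`Dic_m`, …) they were written for; they apply only when `w` is injective (`injective_of_hflip`: `|G| ≤ 2ᵏ`, the cyclic `2`-groups, where the arc
type is Kubota-nondegenerate and gen 38ʼs `Nondegenerate.two_pow_smul_mem_of_reduction` already applies).

THE OBSTRUCTION is the FIBRE FUNCTIONAL `Λ_{s,n}(y) = typeSum y (s) − typeSum y (s·n)` for `n ∈ ker w ∖ {1}`:
* it vanishes on `hodgeSpan` (constant type sums: faces, pairs, all base changes of `S₀ ⊆ hodgeSpan`) and on every base change of the arc type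
  (`indG_rt_arcType_eq`: membership in `T_a·Q⁻¹` depends on `w` only, and `w (s·n) = w s`) — `typeSum_apply_eq_of_mem_arcTarget`;
* on the single flip `T_0^{(s)}` it is `0 − 1 = −1` (`typeSum_single_oflipCM_self`, `typeSum_single_oflipCM_mul`: the flip removes `s` from `T_0`
  but keeps `s·n ∈ T_0`).
Numerically (gen 42 `py/obstruct.py`): `rank(ℤ⟨faces⟩ + ℤ⟨pairs⟩ + ℤ⟨arc block⟩) = 2^{|G|/2 − 1} − (|G|/2 − 2ᵏ⁻¹)` (`Dic₃` 28/32, `Dic₅` 504/512,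
`ℤ/12` 28/32, `ℤ/3 ⋊ ℤ/8` 2040/2048) and ALL `|G|/2` single flips lie outside it even rationally; for `ℤ/8` (`ker w = 1`) all lie inside.

THE REPAIR is part XII (`Census/CyclicCharacterFlipOrbit.lean`, this gen): the reduction target must be the arc block TOGETHER WITH ONE ORBIT OF
SINGLE FLIPS, plus the reduction of ONE FIBRE SUM of single flips onto the arc block — both satisfiable, and sufficient.

## References
* [Pohlmann1968] H. Pohlmann, Algebraic cycles on abelian varieties of complex multiplication type, Ann. of Math. 88 (1968), Thm 1.
* [Milne1999] J. S. Milne, Lefschetz motives and the Tate conjecture, Compositio Math. 117 (1999), Prop. 2.1, p. 54.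
-/

namespace Summit.HodgeConjecture.CorCM.Census.CyclicCharacter

open Finset
open Summit.HodgeConjecture.CorCM.Prior.AllgGroup.RfwfAllgGroup
open Summit.HodgeConjecture.CorCM.Census.BlockParity
open Summit.HodgeConjecture.CorCM.Census.Coinvariant
open Summit.HodgeConjecture.CorCM.Census.TwistGeneration
open Summit.HodgeConjecture.CorCM.Census.OddIndex

noncomputable section

variable {G : Type*} [Group G] [Fintype G] [DecidableEq G] {k : ℕ} {w : G → ZMod (2 ^ k)} {c : G}

/-! ## §1 The fibre functional vanishes on the target lattice of `hflip` -/

/-- **Membership in a base change of an arc type depends on `w` only**: `1_{T_a·Q⁻¹}(x) = 1_{T_a·Q⁻¹}(x')` whenever `w x = w x'`. [folklore] -/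
theorem indG_rt_arcType_eq (hw : ∀ P Q : G, w (P * Q) = w P + w Q) (hk : 1 ≤ k) (hc2 : c * c = 1) (hwc : w c ≠ 0) (Q : G)
    (a : ZMod (2 ^ k)) {x x' : G} (h : w x = w x') :
    indG (rt c Q (arcType hw hk hc2 hwc a)).1 x = indG (rt c Q (arcType hw hk hc2 hwc a)).1 x' := by
  unfold indG
  simp only [mem_rt, mem_arcType, hw, h]

/-- **Hodge vectors have constant type sum**, pointwise form. [folklore] -/
theorem typeSum_apply_eq_of_mem_hodgeSpan (hc2 : c * c = 1) (hcen : ∀ x : G, x * c = c * x) {y : CMF G c →₀ ℤ}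
    (hy : y ∈ hodgeSpan c hc2) (x x' : G) : typeSum G c y x = typeSum G c y x' := by
  obtain ⟨K, hK⟩ := exists_forall_typeSum_eq_of_mem_hodgeSpan c hc2 hcen hy
  rw [hK, hK]

/-- **The type sum of a combination of base changes of an arc type is fibre-constant.** [folklore] -/
theorem typeSum_sum_smul_single_rt_arcType_eq (hw : ∀ P Q : G, w (P * Q) = w P + w Q) (hk : 1 ≤ k) (hc2 : c * c = 1) (hwc : w c ≠ 0)
    (a : ZMod (2 ^ k)) (b : G → ℤ) {x x' : G} (h : w x = w x') :
    typeSum G c (∑ Q, b Q • Finsupp.single (rt c Q (arcType hw hk hc2 hwc a)) (1 : ℤ)) x =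
      typeSum G c (∑ Q, b Q • Finsupp.single (rt c Q (arcType hw hk hc2 hwc a)) (1 : ℤ)) x' := by
  rw [map_sum, Finset.sum_apply, Finset.sum_apply]
  refine Finset.sum_congr rfl fun Q _ => ?_
  rw [map_smul, Pi.smul_apply, Pi.smul_apply, typeSum_single, indG_rt_arcType_eq hw hk hc2 hwc Q a h]

/-- **THE FIBRE FUNCTIONAL VANISHES ON THE TARGET OF `hred` / `hflip`**: every `y ∈ L + ℤ⟨arc block⟩` with `L ≤ hodgeSpan` has
`typeSum y (x) = typeSum y (x')` whenever `w x = w x'`. [folklore] -/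
theorem typeSum_apply_eq_of_mem_arcTarget (hw : ∀ P Q : G, w (P * Q) = w P + w Q) (hk : 1 ≤ k) (hc2 : c * c = 1)
    (hcen : ∀ x : G, x * c = c * x) (hwc : w c ≠ 0) (L : Submodule ℤ (CMF G c →₀ ℤ)) (hL : L ≤ hodgeSpan c hc2) {y : CMF G c →₀ ℤ}
    (hy : y ∈ L ⊔ Submodule.span ℤ (Set.range fun Q : G => Finsupp.single (rt c Q (arcType hw hk hc2 hwc 0)) (1 : ℤ)))
    {x x' : G} (h : w x = w x') : typeSum G c y x = typeSum G c y x' := by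
  obtain ⟨l, hl, b, hb, rfl⟩ := Submodule.mem_sup.mp hy
  obtain ⟨a, rfl⟩ := (Submodule.mem_span_range_iff_exists_fun ℤ).mp hb
  rw [map_add, Pi.add_apply, Pi.add_apply, typeSum_apply_eq_of_mem_hodgeSpan hc2 hcen (hL hl) x x',
    typeSum_sum_smul_single_rt_arcType_eq hw hk hc2 hwc 0 a h]

/-! ## §2 … but separates two points of one fibre on a single flip -/

/-- **The single flip `T_0^{(s)}` omits `s`**: its type sum vanishes at `s` (`s ∈ T_0`). [folklore] -/
theorem typeSum_single_oflipCM_self (hc2 : c * c = 1) (T₀ : CMF G c) {s : G} (hs : s ∈ T₀.1) :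
    typeSum G c (Finsupp.single (oflipCM c hc2 s T₀) (1 : ℤ)) s = 0 := by
  rw [typeSum_single]
  show indG (oflip c s T₀.1) s = 0
  rw [indG_oflip_of_mem c ((mem_orb c).mpr (Or.inl rfl))]
  unfold indG
  rw [if_pos hs, sub_self]

/-- **… but keeps `s·n` for `n ∈ ker w ∖ {1}`**: the type sum of `T_0^{(s)}` at `s·n` is `1`. [folklore] -/
theorem typeSum_single_oflipCM_mul (hw : ∀ P Q : G, w (P * Q) = w P + w Q) (hk : 1 ≤ k) (hc2 : c * c = 1) (hwc : w c ≠ 0)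
    {s n : G} (hs : s ∈ (arcType hw hk hc2 hwc 0).1) (hn : w n = 0) (hn1 : n ≠ 1) :
    typeSum G c (Finsupp.single (oflipCM c hc2 s (arcType hw hk hc2 hwc 0)) (1 : ℤ)) (s * n) = 1 := by
  rw [typeSum_single]
  show indG (oflip c s (arcType hw hk hc2 hwc 0).1) (s * n) = 1
  have hno : s * n ∉ orb c s := by
    rw [mem_orb]
    rintro (h | h)
    · exact hn1 (mul_left_cancel (h.trans (mul_one s).symm))
    · have h' := congrArg w h
      rw [hw, hw, hn, add_zero] at h'
      have h'' : w c + w s = 0 + w s := by rw [zero_add]; exact h'.symm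
      exact hwc (add_right_cancel h'')
  rw [indG_oflip_of_not_mem c hno]
  unfold indG
  rw [if_pos]
  rw [mem_arcType, hw, hn, add_zero]
  exact (mem_arcType hw hk hc2 hwc 0 s).mp hs

/-! ## §3 THE OBSTRUCTION: `hred` and `hflip` fail at every single flip when `ker w ≠ 1` -/

/-- **THE FIBRE OBSTRUCTION.**  For `L ≤ hodgeSpan`, `s ∈ T_0` and `n ∈ ker w ∖ {1}`:  `2ʲ·[T_0^{(s)}] ∉ L + ℤ⟨arc block⟩`.  In particular the
hypothesis `hred` of `two_pow_smul_mem_of_arc_reduction` fails at `Φ = T_0^{(s)}`. [folklore] -/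
theorem not_two_pow_smul_single_oflipCM_mem (hw : ∀ P Q : G, w (P * Q) = w P + w Q) (hk : 1 ≤ k) (hc2 : c * c = 1)
    (hcen : ∀ x : G, x * c = c * x) (hwc : w c ≠ 0) (L : Submodule ℤ (CMF G c →₀ ℤ)) (hL : L ≤ hodgeSpan c hc2) {s n : G}
    (hs : s ∈ (arcType hw hk hc2 hwc 0).1) (hn : w n = 0) (hn1 : n ≠ 1) (j : ℕ) :
    ((2 : ℤ) ^ j) • Finsupp.single (oflipCM c hc2 s (arcType hw hk hc2 hwc 0)) (1 : ℤ) ∉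
      L ⊔ Submodule.span ℤ (Set.range fun Q : G => Finsupp.single (rt c Q (arcType hw hk hc2 hwc 0)) (1 : ℤ)) := by
  intro hmem
  have h := typeSum_apply_eq_of_mem_arcTarget hw hk hc2 hcen hwc L hL hmem (x := s) (x' := s * n) (by rw [hw, hn, add_zero])
  rw [map_smul, Pi.smul_apply, Pi.smul_apply, typeSum_single_oflipCM_self hc2 _ hs, typeSum_single_oflipCM_mul hw hk hc2 hwc hs hn hn1,
    smul_eq_mul, smul_eq_mul, mul_zero, mul_one] at h
  exact pow_ne_zero j two_ne_zero h.symm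

/-- **THE FIBRE OBSTRUCTION, `hflip` form**: for `S ⊆ hodgeSpan`, `s ∈ T_0`, `n ∈ ker w ∖ {1}` and every `j`,
`2ʲ·[T_0^{(s)}] ∉ (ℤ⟨pairs⟩ + ℤ[G]·S) + ℤ⟨arc block⟩`. [folklore] -/
theorem not_two_pow_smul_single_oflipCM_mem_psp (hw : ∀ P Q : G, w (P * Q) = w P + w Q) (hk : 1 ≤ k) (hc2 : c * c = 1)
    (hcen : ∀ x : G, x * c = c * x) (hwc : w c ≠ 0) (S : Finset (CMF G c →₀ ℤ)) (hS : (↑S : Set (CMF G c →₀ ℤ)) ⊆ hodgeSpan c hc2)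
    {s n : G} (hs : s ∈ (arcType hw hk hc2 hwc 0).1) (hn : w n = 0) (hn1 : n ≠ 1) (j : ℕ) :
    ((2 : ℤ) ^ j) • Finsupp.single (oflipCM c hc2 s (arcType hw hk hc2 hwc 0)) (1 : ℤ) ∉
      (Submodule.span ℤ (pairSet c) ⊔ Submodule.span ℤ (translates c S)) ⊔
        Submodule.span ℤ (Set.range fun Q : G => Finsupp.single (rt c Q (arcType hw hk hc2 hwc 0)) (1 : ℤ)) :=
  not_two_pow_smul_single_oflipCM_mem hw hk hc2 hcen hwc _ (psp_le_hodgeSpan c hc2 hcen S hS) hs hn hn1 j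

/-- `1 ∈ T_0`. [folklore] -/
theorem one_mem_arcType_zero (hw : ∀ P Q : G, w (P * Q) = w P + w Q) (hk : 1 ≤ k) (hc2 : c * c = 1) (hwc : w c ≠ 0) :
    (1 : G) ∈ (arcType hw hk hc2 hwc 0).1 := by
  rw [mem_arcType, map_one hw, sub_zero, ZMod.val_zero]
  exact Nat.two_pow_pos (k - 1)

/-- **COROLLARY: `hflip` forces `ker w = 1`.**  If the hypothesis `hflip` of `two_pow_smul_mem_psp_of_single_flips` /
`isLeast_card_gfaces_generate_of_arcCert_isPGroup/_rel/_supported` holds for some `S ⊆ hodgeSpan` and some `j`, then `w n = 0 ⟹ n = 1`. [folklore] -/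
theorem apply_eq_zero_imp_eq_one_of_hflip (hw : ∀ P Q : G, w (P * Q) = w P + w Q) (hk : 1 ≤ k) (hc2 : c * c = 1)
    (hcen : ∀ x : G, x * c = c * x) (hwc : w c ≠ 0) (S : Finset (CMF G c →₀ ℤ)) (hS : (↑S : Set (CMF G c →₀ ℤ)) ⊆ hodgeSpan c hc2)
    (j : ℕ)
    (hflip : ∀ s ∈ (arcType hw hk hc2 hwc 0).1, ((2 : ℤ) ^ j) • Finsupp.single (oflipCM c hc2 s (arcType hw hk hc2 hwc 0)) (1 : ℤ) ∈
      (Submodule.span ℤ (pairSet c) ⊔ Submodule.span ℤ (translates c S)) ⊔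
        Submodule.span ℤ (Set.range fun Q : G => Finsupp.single (rt c Q (arcType hw hk hc2 hwc 0)) (1 : ℤ)))
    (n : G) (hn : w n = 0) : n = 1 := by
  by_contra hn1
  exact not_two_pow_smul_single_oflipCM_mem_psp hw hk hc2 hcen hwc S hS (one_mem_arcType_zero hw hk hc2 hwc) hn hn1 j
    (hflip 1 (one_mem_arcType_zero hw hk hc2 hwc))

/-- **COROLLARY: `hred` forces `ker w = 1`.**  If every type reduces onto the arc block modulo some `L ≤ hodgeSpan` up to `2ʲ`
(the hypothesis `hred` of `two_pow_smul_mem_of_arc_reduction`), then `w n = 0 ⟹ n = 1`. [folklore] -/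
theorem apply_eq_zero_imp_eq_one_of_hred (hw : ∀ P Q : G, w (P * Q) = w P + w Q) (hk : 1 ≤ k) (hc2 : c * c = 1)
    (hcen : ∀ x : G, x * c = c * x) (hwc : w c ≠ 0) (L : Submodule ℤ (CMF G c →₀ ℤ)) (hL : L ≤ hodgeSpan c hc2) (j : ℕ)
    (hred : ∀ Φ : CMF G c, ((2 : ℤ) ^ j) • Finsupp.single Φ (1 : ℤ) ∈
      L ⊔ Submodule.span ℤ (Set.range fun Q : G => Finsupp.single (rt c Q (arcType hw hk hc2 hwc 0)) (1 : ℤ)))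
    (n : G) (hn : w n = 0) : n = 1 := by
  by_contra hn1
  exact not_two_pow_smul_single_oflipCM_mem hw hk hc2 hcen hwc L hL (one_mem_arcType_zero hw hk hc2 hwc) hn hn1 j (hred _)

/-! ## §4 The surviving case: `w` injective, `|G| ≤ 2ᵏ` -/

omit [Fintype G] [DecidableEq G] in
/-- A character with trivial kernel is injective. [folklore] -/
theorem injective_of_apply_eq_zero_imp (hw : ∀ P Q : G, w (P * Q) = w P + w Q) (h : ∀ n : G, w n = 0 → n = 1) :
    Function.Injective w := by
  intro a b hab
  have h0 : w (a * b⁻¹) = 0 := by rw [hw, map_inv hw, hab, add_neg_cancel]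
  exact mul_inv_eq_one.mp (h _ h0)

/-- **Where the arc META theorems of part X are not vacuous, `w` is injective and `|G| ≤ 2ᵏ`** — `G` embeds in `ℤ/2ᵏ` (a cyclic `2`-group),
the arc type has trivial stabiliser, and gen 38ʼs nondegenerate reduction applies directly. [folklore] -/
theorem card_le_of_hflip (hw : ∀ P Q : G, w (P * Q) = w P + w Q) (hk : 1 ≤ k) (hc2 : c * c = 1)
    (hcen : ∀ x : G, x * c = c * x) (hwc : w c ≠ 0) (S : Finset (CMF G c →₀ ℤ)) (hS : (↑S : Set (CMF G c →₀ ℤ)) ⊆ hodgeSpan c hc2)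
    (j : ℕ)
    (hflip : ∀ s ∈ (arcType hw hk hc2 hwc 0).1, ((2 : ℤ) ^ j) • Finsupp.single (oflipCM c hc2 s (arcType hw hk hc2 hwc 0)) (1 : ℤ) ∈
      (Submodule.span ℤ (pairSet c) ⊔ Submodule.span ℤ (translates c S)) ⊔
        Submodule.span ℤ (Set.range fun Q : G => Finsupp.single (rt c Q (arcType hw hk hc2 hwc 0)) (1 : ℤ))) :
    Function.Injective w ∧ Fintype.card G ≤ 2 ^ k := by
  have hinj := injective_of_apply_eq_zero_imp hw (apply_eq_zero_imp_eq_one_of_hflip hw hk hc2 hcen hwc S hS j hflip)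
  refine ⟨hinj, ?_⟩
  have h := Fintype.card_le_of_injective w hinj
  rwa [ZMod.card] at h

end

end Summit.HodgeConjecture.CorCM.Census.CyclicCharacter
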